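import Mathlib
import Summits.Ventures.HodgeRepro.Tier4.Common.Automorphic
import Summits.Ventures.HodgeRepro.Tier4.Target
import Summits.Ventures.HodgeRepro.Tier4.Common.TargetBridge
import Summits.Ventures.HodgeRepro.Tier4.Common.ConcreteAssembly
import Summits.Ventures.HodgeRepro.Tier4.Common.CornerHolo
import Summits.Ventures.HodgeRepro.Tier4.Common.ConcreteCocompact
import Summits.Ventures.HodgeRepro.Tier4.Line1.RealisedSetting

/-!
# Tier4/Line1/RealisedDatum — the TREE TWINS of LINE L1's Part II / Part III datum structures
(Skeleton-v0.32.lean L959–L1190), sorry-free: `RTFDatum` with `Defined` / `Free` / `Content`, the glue to (P′) and (P),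
`exists_rtfDatum_defined`, `Datum4` with `Content` and `conclusion_of_content`

Blind re-derivation cell `pub-hodge-repro`, Tier 4 (README §9–§10), seat t4-L1-p3 (gen 2); planner's ruling
t4-plan-1 g1 S13331 («YES, TREE TWINS — `Tier4/Line1/RealisedDatum.lean`, definition lane; field lists VERBATIM from
Skeleton-v0.32.lean; names exactly as in the skeleton; the datum's setting = typer-2's `Setting.ofAdelicData` with
`DG := Classical.choose (quotient_compact_genuine pl hdef hgen μ)`; docstrings with the scope clauses verbatim»).
Target tree path `lean/Summits/Ventures/HodgeRepro/Tier4/Line1/RealisedDatum.lean`; the Part I′ setting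
`Setting.ofAdelic` and its J1 / J2 are the companion `RealisedSetting.lean` (imported).

WHAT IS HERE (disclosed for the critics' byte diff): Part II (Skeleton-v0.32.lean L959–L1128: `RTFDatum` with the
v0.32 field `hgen` after `hdef` and the instance fields `[fk] [nk] [ms] [bs] [haar] [haarT] [haarT']`, the
`attribute [instance]` line, `RTFDatum.S`, `Defined`, `Free`, `Content`, `isCharacter`, `isCharacter'`, `centralMatch`,
`exists_periods`, `P'_of_content`, `P_of_content`, `exists_rtfDatum_defined` with its binders) and Part III
(L1143–L1190: `Datum4`, `Datum4.witness`, `Datum4.Content`, `P_of_content`, `conclusion_of_content`), every statement,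
field list and proof BYTE-IDENTICAL to the skeleton; the only change is that `Setting.ofAdelic`, the bridges and J1 / J2
they consume are now the tree's (`RealisedSetting`).  NOT here (they stay in the skeleton): the costume
`line1_realise (d : TargetData F E) : ∃ Y : Datum4 d, Y.Content`, `concl_of_datum`, `target_L1`.

SCOPE CLAUSES carried from the skeleton (v0.27 TWIST TEST, lead g385 RULINGS II S12879, verbatim from the docstring of
`line1_realise`): «N2 = `chi_centre` (`χ = χ′` on the centre `Z = E¹(𝔸)`), i.e. `ε := ν₀ ν₁ ν̄₂ ν̄₃ ≡ 1` on
`E¹(𝔸)` […] on `E¹(𝔸_f)` N2 is a HYPOTHESIS on the datum, the product character of the identification, invisible to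
`P_T4`'s data»; «N2 is LOAD-BEARING, not decoration: for `z ∈ Z(𝔸)` the substitution `(t, t′) ↦ (zt, zt′)` in
`J(f) = ∫_{[T]}∫_{[T′]} K_f(t, t′) χ(t) conj χ′(t′)` gives `J(f) = ε(z) J(f)`, so for `ε ≢ 1` on `E¹(𝔸)` the whole
RTF distribution vanishes identically»; «the free half is the `Free` structure, owed by the construction of
`line1_realise`» — here N2 is the field `RTFData.chi_centre` of the datum's `R`, displayed as such.
Nothing here says anything about the status of the Hodge conjecture for CM abelian varieties, which is NOT proved
(HC_CM is NOT proved by anyone in this repository).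
-/

set_option autoImplicit false

noncomputable section

namespace Summit.Ventures.HodgeRepro.Tier4.Line1

open NumberField PeriodCloser Common MeasureTheory Topology

/-! ## Part II — from the RTF on the DEFINED adelic objects to (P′) and (P) on the face (v0.7) -/

variable {L : Type} [Field L] [NumberField L] [IsCMField L]
variable {Form : Type} [AddCommGroup Form] [Module ℂ Form] {A : FormAlgebra Form} {W : Witness A}
  {Θ : ThetaLifts W}

/-- **The RTF datum of the line for the side `E`** (DATA only, every object DEFINED): the totally real field
`k = E′⁺`, the hermitian plane `W = W₀ ⊕ W₁` of the seesaw as a `PlaneData k` (Adelic v0.4), definite at a real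
place, the adelic data `RTFData` (the characters `χ = χ₀ ⊗ χ₁`, `χ′ = χ₂ ⊗ χ₃`, the torus measures and fundamental
domains), a Haar measure on `U(W)(𝔸_k)`, an adapted orthonormal family `(τ, φ, n)` of the discrete spectrum, the
isolating pair of test functions `(f₁, f₂)` with `f = f₁ ⋆ f₂`, the isolated rational double coset `o₀`, the base
choice of translates and the pin `tau` of the invariant subspaces into the face's `Tau`. -/
structure RTFDatum (E : EndoscopicSide L W Θ) where
  /-- the totally real field `k = E′⁺` -/
  k : Type
  [fk : Field k]
  [nk : NumberField k]
  /-- the hermitian plane of the seesaw in a `k`-basis (Adelic v0.4's `PlaneData`) -/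
  pl : PlaneData k
  /-- the plane is definite at a real place (Liu 2021 Lemma D.2(2)) -/
  hdef : IsDefinite pl
  /-- the plane is genuine (v0.32: the hypothesis of (I1-c) and of J2, `exists_rtfDatum_defined` demanded it already) -/
  hgen : IsGenuineRow pl
  [ms : MeasurableSpace (GA pl)]
  [bs : BorelSpace (GA pl)]
  /-- the characters, torus measures and fundamental domains (Adelic v0.4's `RTFData`) -/
  R : RTFData pl
  /-- a Haar measure on `U(W)(𝔸_k)` -/
  μ : Measure (GA pl)
  [haar : μ.IsHaarMeasure]
  [haarT : R.μT.IsHaarMeasure]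
  [haarT' : R.μT'.IsHaarMeasure]
  /-- the torus domain is relatively compact ((I1-c′) supplies one) -/
  hT : IsCompact (closure R.DT)
  /-- the second torus domain is relatively compact ((I1-c″)) -/
  hT' : IsCompact (closure R.DT')
  /-- the invariant subspaces (the discrete spectrum) -/
  τ : ℕ → Set (GA pl → ℂ)
  /-- the adapted orthonormal family -/
  φ : ℕ → GA pl → ℂ
  /-- `φ j ∈ τ (n j)` -/
  n : ℕ → ℕ
  /-- the first factor of the test function (its `S`-components the admissible projector `e_S`, F2′) -/
  f₁ : GA pl → ℂ
  /-- the second factor of the test function -/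
  f₂ : GA pl → ℂ
  /-- the isolated rational double coset -/
  o₀ : (Setting.ofAdelic pl hdef hgen R μ hT hT').Orbit
  /-- the base choice of translates -/
  base : E.toC7Face.Datum
  /-- the pin of the invariant subspaces into the face's `Tau` -/
  tau : ℕ → E.toC7Face.Tau

attribute [instance] RTFDatum.fk RTFDatum.nk RTFDatum.ms RTFDatum.bs RTFDatum.haar RTFDatum.haarT
  RTFDatum.haarT'

namespace RTFDatum

variable {E : EndoscopicSide L W Θ} (Y : RTFDatum E)

/-- the generic setting of the datum (Part I′ on its defined objects) -/
def S : RTF.Setting (GA Y.pl) := Setting.ofAdelic Y.pl Y.hdef Y.hgen Y.R Y.μ Y.hT Y.hT'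

/-- **THE DEFINED CONTENT of the RTF datum** — every field a predicate of Part I over DEFINED objects: the
characters are continuous and unitary, the family is an adapted orthonormal basis (J1), the test functions isolate one
rational double coset with a non-zero orbital term (J2). -/
structure Defined : Prop where
  /-- `χ` is continuous -/
  hc : Continuous Y.R.chi
  /-- `χ` is unitary -/
  hu : ∀ a, ‖Y.R.chi a‖ = 1
  /-- `χ′` is continuous -/
  hc' : Continuous Y.R.chi'
  /-- `χ′` is unitary -/
  hu' : ∀ a, ‖Y.R.chi' a‖ = 1
  /-- (J1) the adapted orthonormal family is complete in `L²(DG)` -/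
  hB : Y.S.IsAdaptedONB Y.τ Y.φ Y.n
  /-- `f₁` is a test function -/
  h₁ : RTF.IsTest Y.f₁
  /-- `f₂` is a test function -/
  h₂ : RTF.IsTest Y.f₂
  /-- `f₁ ⋆ f₂` is a test function -/
  hconv : RTF.IsTest (Y.S.conv Y.f₁ Y.f₂)
  /-- (J2) exactly one rational double coset meets the support of `f₁ ⋆ f₂` on `DT × DT′` -/
  hiso : Y.S.geoSupport (Y.S.conv Y.f₁ Y.f₂) = {Y.o₀}
  /-- (J2) its orbital term is non-zero -/
  hne : Y.S.orbital Y.R.chi Y.R.chi' Y.o₀ (Y.S.conv Y.f₁ Y.f₂) ≠ 0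

/-- **THE FREE HYPOTHESES of the RTF datum** (R1 (i), listed by name; nothing following from them and Mathlib alone
counts as closed): the pins of the defined toric functionals to the face's `toricPeriodNonzero`, and the lift
`F1 + F2` (Rallis at the edge, local non-vanishing, the admissible projector in `f₁`). -/
structure Free : Prop where
  /-- FREE pin: the defined `χ`-functional on `τ m` IS the face's first toric period on `tau m` -/
  pinT : ∀ m, Y.S.PeriodNonzeroT Y.R.chi (Y.τ m) → E.toC7Face.toricPeriodNonzero 0 Y.base (Y.tau m)
  /-- FREE pin: the defined `χ′`-functional on `τ m` IS the face's second toric period on `tau m` -/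
  pinT' : ∀ m, Y.S.PeriodNonzeroT' Y.R.chi' (Y.τ m) → E.toC7Face.toricPeriodNonzero 1 Y.base (Y.tau m)
  /-- FREE F1 + F2: an invariant subspace hit by `f̄₁` (admissible type) with both toric functionals has a non-zero
  `(2,0)`-theta lift (Rallis at `s = 1` + edge value + local non-vanishing; t4-lit-6's `liftNonzero_of_printed`) -/
  lift : ∀ m, Y.S.PeriodNonzeroT Y.R.chi (Y.τ m) → Y.S.PeriodNonzeroT' Y.R.chi' (Y.τ m) →
    Y.S.Hit (RTF.cj Y.f₁) (Y.τ m) → E.toC7Face.liftNonzero (Y.tau m)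

/-- the content of the datum = the defined part and the free part -/
structure Content : Prop where
  defined : Y.Defined
  free : Y.Free

/-- glue (PROVED): the character `χ` of the datum is an `IsCharacter` of its setting. -/
theorem isCharacter (h : Y.Defined) : Y.S.IsCharacter Y.R.chi :=
  isCharacter_ofAdelic Y.pl Y.hdef Y.hgen Y.R Y.μ Y.hT Y.hT' h.hc h.hu

/-- glue (PROVED): the character `χ′` of the datum is an `IsCharacter'` of its setting. -/
theorem isCharacter' (h : Y.Defined) : Y.S.IsCharacter' Y.R.chi' :=
  isCharacter'_ofAdelic Y.pl Y.hdef Y.hgen Y.R Y.μ Y.hT Y.hT' h.hc' h.hu'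

/-- glue (PROVED): N2 on the datum, from the `RTFData`. -/
theorem centralMatch : Y.S.CentralMatch Y.R.chi Y.R.chi' := Y.R.chi_centre

/-- **the periods from the defined content** (PROVED: the generic assembly `exists_periods_of_isolation`). -/
theorem exists_periods (h : Y.Defined) :
    ∃ m, Y.S.PeriodNonzeroT Y.R.chi (Y.τ m) ∧ Y.S.PeriodNonzeroT' Y.R.chi' (Y.τ m) ∧
      Y.S.Hit (RTF.cj Y.f₁) (Y.τ m) :=
  Y.S.exists_periods_of_isolation (Y.isCharacter h) (Y.isCharacter' h) h.hB h.h₁ h.h₂ h.hconv h.hiso h.hne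

/-- **(P′) for the face from the content** (PROVED: the periods + the free pins). -/
theorem P'_of_content (h : Y.Content) : E.toC7Face.P' := by
  obtain ⟨m, hT, hT', hhit⟩ := Y.exists_periods h.defined
  refine ⟨Y.base, Y.tau m, ?_, h.free.lift m hT hT' hhit⟩
  intro i
  fin_cases i
  · exact h.free.pinT m hT
  · exact h.free.pinT' m hT'

/-- **(P) for the witness from the content and the seesaw components** (PROVED: the landed
`P_of_P'_of_components` and `toC7Face_P`). -/
theorem P_of_content (h : Y.Content)
    (hS : ∃ S : SpectralInterface E.toC7Face, SeesawComponents E.toC7Face S) : W.P :=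
  E.toC7Face_P.mp (P_of_P'_of_components E.toC7Face hS.choose hS.choose_spec (Y.P'_of_content h))

end RTFDatum

/-- **glue (PROVED from J1 and J2): a datum with the DEFINED content exists for every definite plane, adelic data
with continuous unitary characters, and pin data** — the defined half of the instance cut composes; the free half is
the `Free` structure, owed by the construction of `line1_realise`. -/
theorem exists_rtfDatum_defined (E : EndoscopicSide L W Θ) (k : Type) [Field k] [NumberField k]
    (pl : PlaneData k) (hdef : IsDefinite pl) (hgen : IsGenuineRow pl) [MeasurableSpace (GA pl)] [BorelSpace (GA pl)]
    (R : RTFData pl) (μ : Measure (GA pl)) [μ.IsHaarMeasure] [R.μT.IsHaarMeasure] [R.μT'.IsHaarMeasure]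
    (hT : IsCompact (closure R.DT)) (hT' : IsCompact (closure R.DT')) (hc : Continuous R.chi)
    (hu : ∀ a, ‖R.chi a‖ = 1) (hc' : Continuous R.chi') (hu' : ∀ a, ‖R.chi' a‖ = 1)
    (base : E.toC7Face.Datum) (tau : ℕ → E.toC7Face.Tau) : ∃ Y : RTFDatum E, Y.Defined := by
  obtain ⟨τ, φ, n, hB⟩ := exists_adaptedONB pl hdef hgen R μ hT hT'
  obtain ⟨f₁, f₂, o₀, h₁, h₂, hconv, hiso, hne⟩ :=
    exists_isolating_tests pl hdef hgen R μ hT hT' hc hu hc' hu'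
  exact ⟨⟨k, pl, hdef, hgen, R, μ, hT, hT', τ, φ, n, f₁, f₂, o₀, base, tau⟩,
    ⟨hc, hu, hc', hu', hB, h₁, h₂, hconv, hiso, hne⟩⟩

/-! ## Part III — the target `P_T4` BY NAME (T4 TARGET FROZEN, S11958: `Tier4/Target.lean` 7e1ddb58699909ce · 263 l.,
p658314 ACCEPTED) through typer-1's `TargetData.lean` (S11982, used BY NAME and not restated: `TargetData` = the universally
quantified objects and hypotheses of `P_T4`, `d.conclusion` = its conclusion verbatim, `P_T4_of_forall : (∀ d, d.conclusion) →
P_T4`) and — v0.18 — typer-1's CONCRETE WITNESS (`ConcreteWitness.lean` p662486 / `ConcreteAssembly.lean` p663626 /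
`CornerHolo.lean` p663860, BY NAME): `d.concreteWitness hΓ' hD hDm R : Witness (d.holoFormAlgebra Γ' hD hDm R.pos R.fin)` is
THE witness of the line on the holomorphic concrete forms of `X_{Γ′}` over the fundamental domain `D`, and
`TargetData.conclusion_of_concrete_P : (d.concreteWitness …).P → d.conclusion` is the bridge.  The abstract dictionary
`Realisation d W` of v0.5–v0.17 is no longer part of the datum: the form algebra, the Hecke action and the corner forms are
typer-1's CONCRETE objects, so the costume no longer constructs a realisation — it constructs the level `Γ′` and its
COCOMPACTNESS `hcc : d.IsCocompact Γ'` (v0.22, typer-1's `ConcreteCocompact.lean` p669425: the canonical domain `dom d Γ'`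
(L4-p1's `CocompactDomain` p667356) is a measurable fundamental domain, relatively compact in the ball when `Γ′` is
cocompact, and the residual bundle `residual_of_cocompact hΓ' hcc : d.ConcreteResidual Γ' (dom d Γ')` is a THEOREM —
(T0) Osgood, (T1) positivity, (T2) Cartan–Serre from the proper discontinuity, (T3) Hecke regularity; `hcc` itself is the
printed Borel–Harish-Chandra input `isCocompact_of_BHC hBHC hΓ'` at every level), the theta lifts and the automorphic side
over the concrete algebra, and the RTF datum of Part II.  v0.5 = the lead's condition S11992. -/

section Target

variable {F E : Type} [Field F] [NumberField F] [IsGalois ℚ F] [IsCMField F]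
  [Field E] [NumberField E] [IsGalois ℚ E] [IsCMField E]

/-- **The realised datum of the line on a datum `d : TargetData F E` of `P_T4`** (v0.22; typer-1's v0.1 of S12014: the
Galois CM fields `F` of the face and `E = E′` of the hermitian space are PARAMETERS): a COCOMPACT level `Γ′ ≤ Γ` and —
over typer-1's CONCRETE WITNESS `d.concreteWitness hΓ' … (d.residual_of_cocompact hΓ' hcc)` on the holomorphic concrete
form algebra of `X_{Γ′}` over the canonical domain `dom d Γ'` — the theta lifts, the endoscopic / automorphic side over
`E′ = E` and the RTF datum of Part II (over the DEFINED adelic objects of Part I′).  The domain and the residual bundle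
are no longer data: both are typer-1's theorems of the cocompactness.  DATA ONLY — its bare existence is cheap (a junk
side); the CONTENT of the line is the proposition `Content` below, and the line's one content lemma is the existence of
a realised datum WITH the content (`line1_realise`). -/
structure Datum4 (d : TargetData F E) where
  /-- the level `Γ′ ≤ Γ` -/
  Γ' : Set (Matrix (Fin 3) (Fin 3) E)
  /-- … a congruence subgroup contained in `Γ` -/
  hΓ' : d.IsLevel Γ'
  /-- … acting cocompactly on the ball (the printed Borel–Harish-Chandra input, `isCocompact_of_BHC`) -/
  hcc : d.IsCocompact Γ'
  /-- the theta lifts on the concrete witness -/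
  Θ : ThetaLifts (d.concreteWitness hΓ' (isDomain_dom d hΓ').subset_ball (isDomain_dom d hΓ').measurableSet
    (d.residual_of_cocompact hΓ' hcc))
  /-- the endoscopic / automorphic side over `E′ = E` -/
  side : EndoscopicSide E (d.concreteWitness hΓ' (isDomain_dom d hΓ').subset_ball (isDomain_dom d hΓ').measurableSet
    (d.residual_of_cocompact hΓ' hcc)) Θ
  /-- the RTF datum of the line for the side (Part II) -/
  rtf : RTFDatum side

namespace Datum4

variable {d : TargetData F E} (Y : Datum4 d)

/-- **The witness of a realised datum** = typer-1's concrete witness at its cocompact level on the canonical domain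
(BY NAME). -/
abbrev witness :
    Witness (d.holoFormAlgebra Y.Γ' (isDomain_dom d Y.hΓ').subset_ball (isDomain_dom d Y.hΓ').measurableSet
      (d.residual_of_cocompact Y.hΓ' Y.hcc).pos (d.residual_of_cocompact Y.hΓ' Y.hcc).fin) :=
  d.concreteWitness Y.hΓ' (isDomain_dom d Y.hΓ').subset_ball (isDomain_dom d Y.hΓ').measurableSet
    (d.residual_of_cocompact Y.hΓ' Y.hcc)

/-- **THE CONTENT of the line on a realised datum** — the pieces the provers prove for the datum they construct
(cut cards in the docstring of `line1_realise`): the four RTF propositions (L1.2a, L1.3, L1.4, the pins) and the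
seesaw components (S1)–(S3) of night-2 for the face. -/
structure Content : Prop where
  /-- the DEFINED hypotheses + isolation + the free pins on the RTF datum (Part II) -/
  rtf : Y.rtf.Content
  /-- (S1)–(S3) for the face (FREE F3) -/
  seesaw : ∃ S : SpectralInterface Y.side.toC7Face, SeesawComponents Y.side.toC7Face S

/-- **(P) for the concrete witness of a realised datum with the content** (PROVED: `RTFDatum.P_of_content`). -/
theorem P_of_content (h : Y.Content) : Y.witness.P :=
  Y.rtf.P_of_content h.rtf h.seesaw

/-- **The conclusion of `P_T4` for `d` from a realised datum with the content** (PROVED: typer-1's bridge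
`TargetData.conclusion_of_concrete_P_cocompact`, the Hecke elements being the values of the translates and the pairing
the integral over `dom d Γ'` BY NAME).  Hence no junk instance satisfies `line1_realise` short of the conclusion itself. -/
theorem conclusion_of_content (h : Y.Content) : d.conclusion :=
  d.conclusion_of_concrete_P_cocompact Y.hΓ' Y.hcc (Y.P_of_content h)

end Datum4

end Target

end Summit.Ventures.HodgeRepro.Tier4.Line1

end
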